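import Mathlib.Data.Nat.Choose.Basic
import Mathlib.Data.List.Basic
import Mathlib.Data.Nat.Factorial.Basic

/-!
# Kernel-checked rows for the maximal-contact definedness test and the second order `b₂`
# of the Abramovich–Temkin–Włodarczyk recursion, in characteristic `p` and `0` (observatory `pub-rosobs`, ENGINE 1)

Abramovich–Temkin–Włodarczyk define, for an ideal `I` of order `a` at a point, a *maximal contact
element* as "an element `x ∈ D^{≤ a−1} I` which is a regular parameter" and the next ideal of their
recursion as the restricted coefficient ideal `I[2] = C(I,a)|_{V(x)}`, `C(I,a) = G_{a!}` where `G` is the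
graded algebra generated by `D^{≤ a−i} I` in degree `i`; `b₂ = ord I[2]`, `a₂ = b₂/(a−1)!`
[cite: AbramovichTemkinWlodarczyk2024, §4.1 Def. 4, §4.2, §5.1 (numbering of arXiv:1906.07106)].  Their theorems are proved in
characteristic `0`; the wording itself "has no mention of characteristic" [cite: AbramovichTemkinWlodarczyk2024, §1.6].

This file is a third, independent and computable implementation (sparse integer polynomials, Hasse
derivatives by binomial coefficients, coefficients reduced mod `p` when `p > 0`) of two numbers the
observatory's ENGINE 1 (`code/eng1/e1a.py`, `e1b.py`) tabulates for a hypersurface `f` at the origin: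

* `dmc p n f` — whether SOME Hasse derivative `D^γ (in f)`, `|γ| = ord f − 1`, has a non-zero linear part,
  i.e. whether `D^{≤ a−1}(f)` contains a regular parameter (the initial form decides it);
* `bnext p n j f` — `b₂ = min_i (a!/i) · ord (D^{≤ a−i} f)|_{v_j = 0}` for the coordinate hyperplane
  `v_j = 0` (used on rows where that hyperplane IS `V(x)`, `x = D^γ f` having linear part `c·v_j`): the
  order of `G_{a!}|_{V}` is attained by powers of the piece minimising `ord/degree` (monomial valuation).

Rows certified by `decide` (each is ONE finite computation, not a theorem about resolution):
Hauser's `x² + y⁷ + yz⁴` (no maximal contact element in characteristic `2`; in characteristic `0` there is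
one and `b₂ = 5`), `E₈ = x² + y³ + z⁵` over `𝔽₅` (`dmc` holds at level 1, `b₂ = 3`), the Fermat cubic cone
`x³ + y³ + z³` over `𝔽₃` (`= (x+y+z)³`: no maximal contact element), `x² + y⁵ + z⁵` over `𝔽₅` (level 1 defined,
`b₂ = 5`; the level-2 ideal `((y+z)⁵) = (y⁵ + z⁵)` has NO maximal contact element — a Frobenius coincidence
making the ATW centre the curve `{x = y+z = 0}`), and the Whitney umbrella over `ℚ` (`b₂ = 3`, `inv = (2,3,3)`).
-/

namespace Literature.AlgebraicGeometry.Resolution.KangarooAtlasCertDMC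

/-- exponent vector. [folklore] -/
abbrev Mon := List ℕ
/-- sparse polynomial with integer coefficients (reduced mod `p` when `p > 0`). [folklore] -/
abbrev Poly := List (Mon × ℤ)

/-- coefficient reduction: exact for `p = 0`, mod `p` otherwise. [folklore] -/
def red (p : ℕ) (c : ℤ) : ℤ := if p = 0 then c else c % (p : ℤ)

/-- insert a term into a normalised list. [folklore] -/
def addTerm (p : ℕ) (t : Mon × ℤ) : Poly → Poly
  | [] => if red p t.2 = 0 then [] else [(t.1, red p t.2)]
  | (m, c) :: rest =>
      if m = t.1 then (if red p (c + t.2) = 0 then rest else (m, red p (c + t.2)) :: rest)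
      else (m, c) :: addTerm p t rest

/-- collect terms, drop zeros. [folklore] -/
def normalize (p : ℕ) (P : Poly) : Poly := P.foldl (fun acc t => addTerm p t acc) []

/-- total degree. [folklore] -/
def deg (m : Mon) : ℕ := m.sum

/-- order (minimum total degree; `0` for the zero polynomial, which never occurs in the rows). [folklore] -/
def ord (P : Poly) : ℕ := match P with
  | [] => 0
  | t :: rest => rest.foldl (fun a s => min a (deg s.1)) (deg t.1)

/-- order as an option (`none` = zero polynomial). [folklore] -/
def ordOpt (P : Poly) : Option ℕ := match P with
  | [] => none
  | _ => some (ord P)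

/-- initial form = terms of minimal degree. [folklore] -/
def initForm (p : ℕ) (P : Poly) : Poly :=
  let Q := normalize p P
  Q.filter (fun t => deg t.1 = ord Q)

/-- `∏ binom(e_i, γ_i)`. [folklore] -/
def binomProd : Mon → Mon → ℕ
  | e :: es, g :: gs => Nat.choose e g * binomProd es gs
  | _, _ => 1

/-- componentwise `e ≥ γ`. [folklore] -/
def dominates : Mon → Mon → Bool
  | e :: es, g :: gs => (g ≤ e) && dominates es gs
  | [], [] => true
  | _, _ => false

/-- Hasse derivative `D^γ P = Σ c · ∏ binom(e_i,γ_i) · v^{e−γ}` (characteristic-free). [cite: AbramovichTemkinWlodarczyk2024, §2.3] -/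
def hasseD (p : ℕ) (γ : Mon) (P : Poly) : Poly :=
  normalize p (P.filterMap fun t =>
    if dominates t.1 γ then some (List.zipWith (· - ·) t.1 γ, t.2 * (binomProd t.1 γ : ℤ)) else none)

/-- all exponent vectors of length `n` and total degree `m`. [folklore] -/
def gammas : ℕ → ℕ → List Mon
  | 0, m => if m = 0 then [[]] else []
  | n + 1, m => (List.range (m + 1)).flatMap fun k => (gammas n (m - k)).map fun g => k :: g

/-- all exponent vectors of length `n` and total degree `≤ m`. [folklore] -/
def gammasUpTo (n m : ℕ) : List Mon := (List.range (m + 1)).flatMap fun k => gammas n k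

/-- does `P` have a term of degree one? [folklore] -/
def hasLinear (P : Poly) : Bool := P.any fun t => deg t.1 = 1

/-- DMC test at the origin: some `D^γ(in f)`, `|γ| = ord f − 1`, has a non-zero linear part
(⟺ `D^{≤ ord−1}(f)` contains a regular parameter). [cite: AbramovichTemkinWlodarczyk2024, §4.2] -/
def dmc (p n : ℕ) (P : Poly) : Bool :=
  let T := initForm p P
  (gammas n (ord T - 1)).any fun γ => hasLinear (hasseD p γ T)

/-- restriction to the coordinate hyperplane `v_j = 0` (drop terms containing `v_j`). [folklore] -/
def restrict0 (j : ℕ) (P : Poly) : Poly := P.filter fun t => t.1.getD j 0 = 0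

/-- `ord (D^{≤ m} f)|_{v_j = 0}` as an option. [cite: AbramovichTemkinWlodarczyk2024, §4.1] -/
def derivOrd (p n j m : ℕ) (P : Poly) : Option ℕ :=
  (gammasUpTo n m).foldl (fun acc γ =>
    match acc, ordOpt (hasseD p γ (normalize p P) |> restrict0 j) with
    | none, o => o
    | some a, none => some a
    | some a, some o => some (min a o)) none

/-- `b₂ = ord G_{a!}|_{v_j=0} = min_{i=1..a} (a!/i) · ord (D^{≤ a−i} f)|_{v_j=0}`. [cite: AbramovichTemkinWlodarczyk2024, §5.1] -/
def bnext (p n j : ℕ) (P : Poly) : Option ℕ :=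
  let a := ord (normalize p P)
  ((List.range a).map fun i0 =>
      (derivOrd p n j (a - (i0 + 1)) P).map fun o => o * (Nat.factorial a / (i0 + 1))).foldl
    (fun acc x => match acc, x with
      | none, o => o
      | some u, none => some u
      | some u, some o => some (min u o)) none

/-! ## Rows (variables ordered `x, y, z`) -/

/-- Hauser's kangaroo surface `x² + y⁷ + y z⁴`. [cite: Hauser2010, §G] -/
def hauser : Poly := [([2,0,0], 1), ([0,7,0], 1), ([0,1,4], 1)]
/-- `E₈`: `x² + y³ + z⁵`. [folklore] -/
def e8 : Poly := [([2,0,0], 1), ([0,3,0], 1), ([0,0,5], 1)]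
/-- Fermat cubic cone `x³ + y³ + z³`. [folklore] -/
def fermat3 : Poly := [([3,0,0], 1), ([0,3,0], 1), ([0,0,3], 1)]
/-- `x² + y⁵ + z⁵`. [folklore] -/
def f255 : Poly := [([2,0,0], 1), ([0,5,0], 1), ([0,0,5], 1)]
/-- its level-2 ideal generator on `V(x)` in the variables `y, z`: `y⁵ + z⁵ = (y+z)⁵` over `𝔽₅`. [folklore] -/
def f255level2 : Poly := [([5,0], 1), ([0,5], 1)]
/-- Whitney umbrella `x² − y² z`. [folklore] -/
def whitney : Poly := [([2,0,0], 1), ([0,2,1], -1)]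

/-- characteristic 2: no Hasse derivative of order 1 of `x² + y⁷ + yz⁴`'s initial form `x²` has a linear part. [cite: Hauser2010, §G] -/
theorem hauser_dmc_char2 : dmc 2 3 hauser = false := by decide
/-- characteristic 0 control: `D_x x² = 2x`. [cite: AbramovichTemkinWlodarczyk2024, §5.1] -/
theorem hauser_dmc_char0 : dmc 0 3 hauser = true := by decide
/-- characteristic 0: `b₂ = 5` on `V(x)` (so `a₂ = 5`, `inv = (2,5,5)`). [cite: AbramovichTemkinWlodarczyk2024, §5.1] -/
theorem hauser_b2_char0 : bnext 0 3 0 hauser = some 5 := by decide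
/-- characteristic 2, directrix hyperplane `x = 0` (a fallback, not an ATW maximal contact element): `b₂ = 5`. [cite: Hauser2010, §G] -/
theorem hauser_b2_char2 : bnext 2 3 0 hauser = some 5 := by decide

/-- `E₈` over `𝔽₅`: level 1 is defined. [cite: AbramovichTemkinWlodarczyk2024, §4.2] -/
theorem e8_dmc_char5 : dmc 5 3 e8 = true := by decide
/-- `E₈` over `𝔽₅`: `b₂ = 3` (`5z⁴ = 0` does not matter: `3y²` has order 2). [cite: AbramovichTemkinWlodarczyk2024, §5.1] -/
theorem e8_b2_char5 : bnext 5 3 0 e8 = some 3 := by decide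
/-- `E₈` over `ℚ`: `b₂ = 3`. [cite: AbramovichTemkinWlodarczyk2024, §5.1] -/
theorem e8_b2_char0 : bnext 0 3 0 e8 = some 3 := by decide

/-- Fermat cubic over `𝔽₃` (`= (x+y+z)³`): no maximal contact element. [folklore] -/
theorem fermat3_dmc_char3 : dmc 3 3 fermat3 = false := by decide
/-- Fermat cubic over `𝔽₇`: defined. [folklore] -/
theorem fermat3_dmc_char7 : dmc 7 3 fermat3 = true := by decide

/-- `x² + y⁵ + z⁵` over `𝔽₅`: level 1 defined, `b₂ = 5`. [cite: AbramovichTemkinWlodarczyk2024, §5.1] -/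
theorem f255_char5 : dmc 5 3 f255 = true ∧ bnext 5 3 0 f255 = some 5 := by decide
/-- … but its level-2 ideal `(y⁵ + z⁵) = ((y+z)⁵)` over `𝔽₅` has no maximal contact element (it has one over `𝔽₇`). [folklore] -/
theorem f255_level2 : dmc 5 2 f255level2 = false ∧ dmc 7 2 f255level2 = true := by decide

/-- Whitney umbrella over `ℚ`: level 1 defined and `b₂ = 3` (`inv = (2,3,3)`). [cite: AbramovichTemkinWlodarczyk2024, §5.1] -/
theorem whitney_char0 : dmc 0 3 whitney = true ∧ bnext 0 3 0 whitney = some 3 := by decide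

end Literature.AlgebraicGeometry.Resolution.KangarooAtlasCertDMC
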